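import Summits.CriticalPhenomena.PercolationContinuityZ3.Theorems.PercNearOneGluingNoHeavyLowerTailStarSetTriangleComonotone
import Summits.CriticalPhenomena.PercolationContinuityZ3.Theorems.PercNearOneGluingNoHeavyLowerTailStarSetTriangleBudget
import Summits.CriticalPhenomena.PercolationContinuityZ3.Theorems.PercNearOneGluingNoHeavyLowerTailStarSetStateExpansion
import HarnessLib

/-!
# `NoHeavyLowerTail` (stmt-CriticalPhenomena-4575) — OES at level `j ≤ 2` for three two-port pendant stars on a TRIANGLE of relays

Support file (prover `prim-gen-swap` gen 9; `--supports stmt-CriticalPhenomena-4575`).  No definitions, no named facts, no sorries.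

**Theorem (`StarSet.setCS_twoPortStarTriangle_levelTwo`).**  Three pairwise distinct non-relay vertices `s i` (`i : Fin 3`), star `i`
joined (with positive weight) only to the two relays `p i = q (i+1)`, `p' i = q (i+2)` of a triangle of distinct relays `q 0, q 1, q 2`;
`c ∈ A` off the triangle with `μ(|π(q d)| ≤ j) ≤ μ(|π(c)| ≤ j)` for the three ports; `j ≤ 2`; everything else in the graph arbitrary, every
`|A|`.  Then `μ(c ↮ S, 1 ≤ |π(S)| ≤ j) ≤ μ(c ↮ S, |π(c)| ≤ j)` for `S = {s 0, s 1, s 2}` — the observer-extension step for a port graph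
that is a CYCLE (of length three), the first case beyond the class forests of …StarSetClassForestLevelTwo (seat memos CYCLES-CERT.md §6,
TRIANGLE-PROOF.md).
Proof: state expansion + extreme regrouping (`StarSet.setCSdiff_state_expansion`, `StarSet.extreme_regroup`); the glued words are
nonnegative (`StarSet.gluedWord_nonneg`); the two ROTATION words (every star glued to a distinct port) equal `μ(c ↮_ξ q, |π_ξ(c)| ≤ j)`
(`StarSet.rotationWord_eq`) and are kept as the hair budget of the comonotone word (`StarSet.comonotone_word_budget_triangle`, with the
coefficient inequality `StarSet.triangle_extremeCoeff_budget` ⇐ `StarSet.triangle_hair_budget`).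
-/

noncomputable section

namespace Summit.CriticalPhenomena.PercolationContinuityZ3.Theorems

open MeasureTheory Set Literature.Probability.LatticeModels Literature.Probability.Percolation
open scoped Classical BigOperators

variable {n : ℕ}

namespace StarSet

/-- **Coefficient form of the hair budget.**  For the extreme coefficients `a_i(k)` of three two-port stars (`StarSet.extreme_regroup`)
and `Σ_i b_i c_i > 2`: `Π_i a_i(0) ≤ 2·(Π_i a_i(1) + Π_i a_i(2))` (the comonotone coefficient is at most twice the two rotation
coefficients); from `StarSet.triangle_hair_budget`. [folklore; TRIANGLE-PROOF.md §5] -/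
theorem triangle_extremeCoeff_budget (b c : Fin 3 → ℝ) (hb0 : ∀ i, 0 ≤ b i) (hb1 : ∀ i, b i ≤ 1) (hc0 : ∀ i, 0 ≤ c i)
    (hc1 : ∀ i, c i ≤ 1) (e₀ e₁ e₂ : Fin 3 → Fin 3) (he₀ : ∀ i, e₀ i = 0) (he₁ : ∀ i, e₁ i = 1) (he₂ : ∀ i, e₂ i = 2)
    (hS : 2 < ∑ i, b i * c i) :
    (∏ i, (if b i * c i < 1 then ((if e₀ i = 1 then b i else 1 - b i) * (if e₀ i = 2 then c i else 1 - c i)) / (1 - b i * c i)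
      else if e₀ i = 1 then 1 else 0)) ≤
    2 * ((∏ i, (if b i * c i < 1 then ((if e₁ i = 1 then b i else 1 - b i) * (if e₁ i = 2 then c i else 1 - c i)) / (1 - b i * c i)
      else if e₁ i = 1 then 1 else 0)) +
      ∏ i, (if b i * c i < 1 then ((if e₂ i = 1 then b i else 1 - b i) * (if e₂ i = 2 then c i else 1 - c i)) / (1 - b i * c i)
      else if e₂ i = 1 then 1 else 0)) := by
  have h01 : ∀ i, e₀ i ≠ 1 := fun i => by rw [he₀ i]; decide
  have h02 : ∀ i, e₀ i ≠ 2 := fun i => by rw [he₀ i]; decide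
  simp only [h01, h02, he₁, he₂, if_true, if_false]
  -- the three normal forms
  set a0 : Fin 3 → ℝ := fun i => if b i * c i < 1 then (1 - b i) * (1 - c i) / (1 - b i * c i) else 0 with ha0
  set a1 : Fin 3 → ℝ := fun i => if b i * c i < 1 then b i * (1 - c i) / (1 - b i * c i) else 1 with ha1
  set a2 : Fin 3 → ℝ := fun i => if b i * c i < 1 then (1 - b i) * c i / (1 - b i * c i) else 0 with ha2
  change ∏ i, a0 i ≤ 2 * (∏ i, a1 i + ∏ i, a2 i)
  have ha0nn : ∀ i, 0 ≤ a0 i := by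
    intro i; simp only [ha0]
    split_ifs with h
    · exact div_nonneg (mul_nonneg (sub_nonneg.2 (hb1 i)) (sub_nonneg.2 (hc1 i))) (by linarith)
    · exact le_refl 0
  have ha1nn : ∀ i, 0 ≤ a1 i := by
    intro i; simp only [ha1]
    split_ifs with h
    · exact div_nonneg (mul_nonneg (hb0 i) (sub_nonneg.2 (hc1 i))) (by linarith)
    · exact zero_le_one
  have ha2nn : ∀ i, 0 ≤ a2 i := by
    intro i; simp only [ha2]
    split_ifs with h
    · exact div_nonneg (mul_nonneg (sub_nonneg.2 (hb1 i)) (hc0 i)) (by linarith)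
    · exact le_refl 0
  have hP1 : 0 ≤ ∏ i, a1 i := Finset.prod_nonneg fun i _ => ha1nn i
  have hP2 : 0 ≤ ∏ i, a2 i := Finset.prod_nonneg fun i _ => ha2nn i
  by_cases hlt : ∀ i, b i < 1 ∧ c i < 1
  · -- all edge probabilities `< 1`: `a1 = r(b)·a0`, `a2 = r(c)·a0`, and `Π r(b) + Π r(c) ≥ 1`
    have hbc : ∀ i, b i * c i < 1 := fun i => by nlinarith [hlt i, hb0 i, hc0 i]
    have h1 : ∀ i, a1 i = b i / (1 - b i) * a0 i := by
      intro i
      simp only [ha1, ha0, if_pos (hbc i)]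
      have : 1 - b i ≠ 0 := by linarith [(hlt i).1]
      field_simp
    have h2 : ∀ i, a2 i = c i / (1 - c i) * a0 i := by
      intro i
      simp only [ha2, ha0, if_pos (hbc i)]
      have : 1 - c i ≠ 0 := by linarith [(hlt i).2]
      field_simp
    rw [Finset.prod_congr rfl fun i _ => h1 i, Finset.prod_congr rfl fun i _ => h2 i, Finset.prod_mul_distrib, Finset.prod_mul_distrib]
    have hP0 : 0 ≤ ∏ i, a0 i := Finset.prod_nonneg fun i _ => ha0nn i
    have hS' : 2 < b 0 * c 0 + b 1 * c 1 + c 2 * b 2 := by rw [Fin.sum_univ_three] at hS; linarith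
    have hbud := triangle_hair_budget (b 0) (c 0) (b 1) (c 1) (c 2) (b 2) (hb0 0) (hlt 0).1 (hc0 0) (hlt 0).2
      (hb0 1) (hlt 1).1 (hc0 1) (hlt 1).2 (hc0 2) (hlt 2).2 (hb0 2) (hlt 2).1 hS'
    simp only [Fin.prod_univ_three] at hP0 ⊢
    nlinarith [mul_nonneg (sub_nonneg.2 hbud) hP0]
  · -- some edge probability equals `1`: the comonotone coefficient vanishes
    push Not at hlt
    obtain ⟨i, hi⟩ := hlt
    have h0 : a0 i = 0 := by
      simp only [ha0]
      split_ifs with h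
      · have : b i = 1 ∨ c i = 1 := by
          by_cases hb : b i < 1
          · exact Or.inr (le_antisymm (hc1 i) (hi hb))
          · exact Or.inl (le_antisymm (hb1 i) (not_lt.1 hb))
        rcases this with h' | h'
        · rw [h']; ring
        · rw [h']; ring
      · rfl
    rw [Finset.prod_eq_zero (Finset.mem_univ i) h0]
    positivity

/-- **A rotation word is the hair budget.**  If every cell port set `Y(σ)` is the whole triangle `{q 0, q 1, q 2}` (three distinct relays,
`j ≤ 2`), then `Σ_σ w(σ)·[μ(c ↮_ξ Y(σ), |π_ξ(c)| ≤ j) − μ(c ↮_ξ Y(σ), 1 ≤ |π_ξ(Y(σ))| ≤ j)] = μ(c ↮_ξ q, |π_ξ(c)| ≤ j)`: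
the lonely event is empty and the pattern weights sum to one. [folklore] -/
theorem rotationWord_eq (w : Sym2 (Fin n) → unitInterval) (A : Finset (Fin n)) (s p p' q : Fin 3 → Fin n)
    (c : Fin n) (j : ℕ) (hj : j ≤ 2) (hqA : ∀ d, q d ∈ A) (hq : Function.Injective q)
    (Y : Finset (Fin 3) → Finset (Fin n)) (hY : ∀ σ u, u ∈ Y σ ↔ ∃ d, u = q d) :
    ∑ σ ∈ (Finset.univ : Finset (Fin 3)).powerset,
      ((∏ i ∈ σ, ((w s(s i, p i) : ℝ) * w s(s i, p' i))) *
          ∏ i ∈ Finset.univ \ σ, (1 - (w s(s i, p i) : ℝ) * w s(s i, p' i))) *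
        ((prodBernoulli w).real {ω : BondConfig (Fin n) |
            (∀ u ∈ Y σ, ¬ (openGraph (ω ∩ {e | ∀ v ∈ Finset.univ.image s, v ∉ e})).Reachable c u) ∧
            (A.filter fun z => (openGraph (ω ∩ {e | ∀ v ∈ Finset.univ.image s, v ∉ e})).Reachable c z).card ≤ j} -
          (prodBernoulli w).real {ω : BondConfig (Fin n) |
            (∀ u ∈ Y σ, ¬ (openGraph (ω ∩ {e | ∀ v ∈ Finset.univ.image s, v ∉ e})).Reachable c u) ∧
            1 ≤ (A.filter fun z => ∃ u ∈ Y σ, (openGraph (ω ∩ {e | ∀ v ∈ Finset.univ.image s, v ∉ e})).Reachable u z).card ∧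
            (A.filter fun z => ∃ u ∈ Y σ,
              (openGraph (ω ∩ {e | ∀ v ∈ Finset.univ.image s, v ∉ e})).Reachable u z).card ≤ j}) =
      (prodBernoulli w).real {ω : BondConfig (Fin n) |
          (∀ d, ¬ (openGraph (ω ∩ {e | ∀ v ∈ Finset.univ.image s, v ∉ e})).Reachable c (q d)) ∧
          (A.filter fun z => (openGraph (ω ∩ {e | ∀ v ∈ Finset.univ.image s, v ∉ e})).Reachable c z).card ≤ j} := by
  set θ : Fin 3 → ℝ := fun i => (w s(s i, p i) : ℝ) * w s(s i, p' i) with hθ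
  set Chi : Set (BondConfig (Fin n)) := {ω |
    (∀ d, ¬ (openGraph (ω ∩ {e | ∀ v ∈ Finset.univ.image s, v ∉ e})).Reachable c (q d)) ∧
      (A.filter fun z => (openGraph (ω ∩ {e | ∀ v ∈ Finset.univ.image s, v ∉ e})).Reachable c z).card ≤ j} with hChi
  have hfirst : ∀ σ : Finset (Fin 3), {ω : BondConfig (Fin n) |
      (∀ u ∈ Y σ, ¬ (openGraph (ω ∩ {e | ∀ v ∈ Finset.univ.image s, v ∉ e})).Reachable c u) ∧
      (A.filter fun z => (openGraph (ω ∩ {e | ∀ v ∈ Finset.univ.image s, v ∉ e})).Reachable c z).card ≤ j} = Chi := by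
    intro σ
    ext ω
    simp only [hChi, mem_setOf_eq]
    constructor
    · rintro ⟨h1, h2⟩
      exact ⟨fun d => h1 (q d) ((hY σ (q d)).2 ⟨d, rfl⟩), h2⟩
    · rintro ⟨h1, h2⟩
      refine ⟨fun u hu => ?_, h2⟩
      obtain ⟨d, rfl⟩ := (hY σ u).1 hu
      exact h1 d
  have hsecond : ∀ σ : Finset (Fin 3), {ω : BondConfig (Fin n) |
      (∀ u ∈ Y σ, ¬ (openGraph (ω ∩ {e | ∀ v ∈ Finset.univ.image s, v ∉ e})).Reachable c u) ∧
      1 ≤ (A.filter fun z => ∃ u ∈ Y σ, (openGraph (ω ∩ {e | ∀ v ∈ Finset.univ.image s, v ∉ e})).Reachable u z).card ∧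
      (A.filter fun z => ∃ u ∈ Y σ,
        (openGraph (ω ∩ {e | ∀ v ∈ Finset.univ.image s, v ∉ e})).Reachable u z).card ≤ j} = ∅ := by
    intro σ
    ext ω
    simp only [mem_setOf_eq, mem_empty_iff_false, iff_false, not_and, not_le]
    intro _ _
    have hsub : Finset.univ.image q ⊆
        A.filter fun z => ∃ u ∈ Y σ, (openGraph (ω ∩ {e | ∀ v ∈ Finset.univ.image s, v ∉ e})).Reachable u z := by
      intro z hz
      obtain ⟨d, -, rfl⟩ := Finset.mem_image.1 hz
      exact Finset.mem_filter.2 ⟨hqA d, q d, (hY σ (q d)).2 ⟨d, rfl⟩, SimpleGraph.Reachable.refl _⟩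
    have hcard : (Finset.univ.image q).card = 3 := by
      rw [Finset.card_image_of_injective _ hq, Finset.card_univ, Fintype.card_fin]
    have := Finset.card_le_card hsub
    omega
  simp only [hfirst, hsecond, measureReal_empty, sub_zero]
  rw [← Finset.sum_mul]
  have hsumW : ∑ σ ∈ (Finset.univ : Finset (Fin 3)).powerset, (∏ i ∈ σ, θ i) * ∏ i ∈ Finset.univ \ σ, (1 - θ i) = 1 := by
    have h := cylinder_sum_closed θ (∅ : Finset (Fin 3))
    simp only [Finset.notMem_empty, IsEmpty.forall_iff, implies_true, if_true, mul_one, Finset.prod_empty] at h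
    exact h
  rw [hsumW, one_mul]

/-- **OES at level `j ≤ 2` for three two-port pendant stars on a triangle of relays** (see the file header): with `S = {s i : i < 3}`,
`μ(c ↮ S, 1 ≤ |π(S)| ≤ j) ≤ μ(c ↮ S, |π(c)| ≤ j)`.
[cite: VandenbergHaggstromKahn2005, Thm. 1.5 (p. 7) — the only non-elementary input, via `observerSet_le_of_lonelier`] -/
theorem setCS_twoPortStarTriangle_levelTwo (w : Sym2 (Fin n) → unitInterval) (A : Finset (Fin n)) (s p p' q : Fin 3 → Fin n)
    (hp : ∀ i, p i = q (i + 1)) (hp' : ∀ i, p' i = q (i + 2))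
    (c : Fin n) (j : ℕ) (hj : j ≤ 2) (hs : Function.Injective s) (hsA : ∀ i, s i ∉ A)
    (hqA : ∀ d, q d ∈ A) (hq : Function.Injective q) (hcA : c ∈ A) (hcq : ∀ d, c ≠ q d)
    (hobs : ∀ i u, u ≠ s i → u ≠ p i → u ≠ p' i → w s(s i, u) = 0)
    (hdom : ∀ d, (prodBernoulli w).real {ω : BondConfig (Fin n) | (A.filter fun z => ω ∈ openConn (q d) z).card ≤ j} ≤
      (prodBernoulli w).real {ω : BondConfig (Fin n) | (A.filter fun z => ω ∈ openConn c z).card ≤ j}) :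
    (prodBernoulli w).real {ω : BondConfig (Fin n) | (∀ x ∈ Finset.univ.image s, ω ∉ openConn c x) ∧
        1 ≤ (A.filter fun z => ∃ x ∈ Finset.univ.image s, ω ∈ openConn x z).card ∧
        (A.filter fun z => ∃ x ∈ Finset.univ.image s, ω ∈ openConn x z).card ≤ j} ≤
      (prodBernoulli w).real {ω : BondConfig (Fin n) | (∀ x ∈ Finset.univ.image s, ω ∉ openConn c x) ∧
        (A.filter fun z => ω ∈ openConn c z).card ≤ j} := by
  -- port facts
  have hpA : ∀ i, p i ∈ A := fun i => (hp i) ▸ hqA (i + 1)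
  have hp'A : ∀ i, p' i ∈ A := fun i => (hp' i) ▸ hqA (i + 2)
  have hpp' : ∀ i, p i ≠ p' i := fun i h => (fin3_facts i).2.2.1 (hq (((hp i).symm.trans h).trans (hp' i)))
  have hcp : ∀ i, c ≠ p i ∧ c ≠ p' i := fun i => ⟨(hp i) ▸ hcq (i + 1), (hp' i) ▸ hcq (i + 2)⟩
  have hdomStar : ∀ i,
      (prodBernoulli w).real {ω : BondConfig (Fin n) | (A.filter fun z => ω ∈ openConn (p i) z).card ≤ j} ≤
          (prodBernoulli w).real {ω : BondConfig (Fin n) | (A.filter fun z => ω ∈ openConn c z).card ≤ j} ∧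
        (prodBernoulli w).real {ω : BondConfig (Fin n) | (A.filter fun z => ω ∈ openConn (p' i) z).card ≤ j} ≤
          (prodBernoulli w).real {ω : BondConfig (Fin n) | (A.filter fun z => ω ∈ openConn c z).card ≤ j} := by
    intro i
    rw [hp i, hp' i]
    exact ⟨hdom _, hdom _⟩
  have hps : ∀ i k, p i ≠ s k := fun i k h => hsA k (h ▸ hpA i)
  have hp's : ∀ i k, p' i ≠ s k := fun i k h => hsA k (h ▸ hp'A i)
  have hcs : ∀ i, c ≠ s i := fun i h => hsA i (h ▸ hcA)
  rw [← sub_nonneg, setCSdiff_state_expansion w A s p p' c j hs hsA hps hp's hpp' hcs hobs]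
  have hre := extreme_regroup (fun i => (w s(s i, p i) : ℝ)) (fun i => (w s(s i, p' i) : ℝ)) (fun i => (w _).2.1)
    (fun i => (w _).2.2) (fun i => (w _).2.1) (fun i => (w _).2.2)
    (fun t => (prodBernoulli w).real {ω : BondConfig (Fin n) |
        (∀ u ∈ (Finset.univ.filter fun i => (t i).1 = true).image p ∪ (Finset.univ.filter fun i => (t i).2 = true).image p',
          ¬ (openGraph (ω ∩ {e | ∀ v ∈ Finset.univ.image s, v ∉ e})).Reachable c u) ∧
        (A.filter fun z => (openGraph (ω ∩ {e | ∀ v ∈ Finset.univ.image s, v ∉ e})).Reachable c z).card ≤ j} -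
      (prodBernoulli w).real {ω : BondConfig (Fin n) |
        (∀ u ∈ (Finset.univ.filter fun i => (t i).1 = true).image p ∪ (Finset.univ.filter fun i => (t i).2 = true).image p',
          ¬ (openGraph (ω ∩ {e | ∀ v ∈ Finset.univ.image s, v ∉ e})).Reachable c u) ∧
        1 ≤ (A.filter fun z => ∃ u ∈ (Finset.univ.filter fun i => (t i).1 = true).image p ∪
            (Finset.univ.filter fun i => (t i).2 = true).image p',
          (openGraph (ω ∩ {e | ∀ v ∈ Finset.univ.image s, v ∉ e})).Reachable u z).card ∧
        (A.filter fun z => ∃ u ∈ (Finset.univ.filter fun i => (t i).1 = true).image p ∪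
            (Finset.univ.filter fun i => (t i).2 = true).image p',
          (openGraph (ω ∩ {e | ∀ v ∈ Finset.univ.image s, v ∉ e})).Reachable u z).card ≤ j})
  beta_reduce at hre
  rw [hre]
  -- the three special words
  set e₀ : Fin 3 → Fin 3 := fun _ => 0 with he₀
  set e₁ : Fin 3 → Fin 3 := fun _ => 1 with he₁
  set e₂ : Fin 3 → Fin 3 := fun _ => 2 with he₂
  have hT : e₀ ∉ ({e₁, e₂} : Finset (Fin 3 → Fin 3)) := by simp [he₀, he₁, he₂, funext_iff]
  have hT' : e₁ ∉ ({e₂} : Finset (Fin 3 → Fin 3)) := by simp [he₁, he₂, funext_iff]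
  rw [← Finset.sum_add_sum_compl ({e₀, e₁, e₂} : Finset (Fin 3 → Fin 3)), Finset.sum_insert hT, Finset.sum_insert hT',
    Finset.sum_singleton]
  -- every glued word is nonnegative
  have hglued : ∀ e : Fin 3 → Fin 3, e ≠ e₀ → 0 ≤
      (∏ i, (if (w s(s i, p i) : ℝ) * w s(s i, p' i) < 1 then
          ((if e i = 1 then (w s(s i, p i) : ℝ) else 1 - w s(s i, p i)) *
            (if e i = 2 then (w s(s i, p' i) : ℝ) else 1 - w s(s i, p' i))) / (1 - (w s(s i, p i) : ℝ) * w s(s i, p' i))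
        else if e i = 1 then 1 else 0)) *
      ∑ σ ∈ (Finset.univ : Finset (Fin 3)).powerset,
        ((∏ i ∈ σ, (w s(s i, p i) : ℝ) * w s(s i, p' i)) * ∏ i ∈ Finset.univ \ σ, (1 - (w s(s i, p i) : ℝ) * w s(s i, p' i))) *
        ((prodBernoulli w).real {ω : BondConfig (Fin n) |
            (∀ u ∈ (Finset.univ.filter fun i => (if i ∈ σ then (true, true) else (decide (e i = 1), decide (e i = 2))).1 = true).image p ∪
                (Finset.univ.filter fun i => (if i ∈ σ then (true, true) else (decide (e i = 1), decide (e i = 2))).2 = true).image p',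
              ¬ (openGraph (ω ∩ {e | ∀ v ∈ Finset.univ.image s, v ∉ e})).Reachable c u) ∧
            (A.filter fun z => (openGraph (ω ∩ {e | ∀ v ∈ Finset.univ.image s, v ∉ e})).Reachable c z).card ≤ j} -
          (prodBernoulli w).real {ω : BondConfig (Fin n) |
            (∀ u ∈ (Finset.univ.filter fun i => (if i ∈ σ then (true, true) else (decide (e i = 1), decide (e i = 2))).1 = true).image p ∪
                (Finset.univ.filter fun i => (if i ∈ σ then (true, true) else (decide (e i = 1), decide (e i = 2))).2 = true).image p',
              ¬ (openGraph (ω ∩ {e | ∀ v ∈ Finset.univ.image s, v ∉ e})).Reachable c u) ∧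
            1 ≤ (A.filter fun z => ∃ u ∈ (Finset.univ.filter fun i =>
                  (if i ∈ σ then (true, true) else (decide (e i = 1), decide (e i = 2))).1 = true).image p ∪
                (Finset.univ.filter fun i => (if i ∈ σ then (true, true) else (decide (e i = 1), decide (e i = 2))).2 = true).image p',
              (openGraph (ω ∩ {e | ∀ v ∈ Finset.univ.image s, v ∉ e})).Reachable u z).card ∧
            (A.filter fun z => ∃ u ∈ (Finset.univ.filter fun i =>
                  (if i ∈ σ then (true, true) else (decide (e i = 1), decide (e i = 2))).1 = true).image p ∪
                (Finset.univ.filter fun i => (if i ∈ σ then (true, true) else (decide (e i = 1), decide (e i = 2))).2 = true).image p',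
              (openGraph (ω ∩ {e | ∀ v ∈ Finset.univ.image s, v ∉ e})).Reachable u z).card ≤ j}) := by
    intro e he
    obtain ⟨i₀, hi₀⟩ : ∃ i₀, e i₀ ≠ 0 := by
      by_contra h
      push Not at h
      exact he (funext fun i => by rw [h i])
    refine mul_nonneg (Finset.prod_nonneg fun i _ =>
      extremeCoeff_nonneg _ _ (w _).2.1 (w _).2.2 (w _).2.1 (w _).2.2 (e i)) ?_
    refine gluedWord_nonneg w A s p p' c j hj hs hsA hpA hp'A hpp' hcA hcp hobs hdomStar e i₀ hi₀ _ ?_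
    intro σ u
    simp only [Finset.mem_union, Finset.mem_image, Finset.mem_filter, Finset.mem_univ, true_and]
    constructor
    · rintro (⟨i, hi, rfl⟩ | ⟨i, hi, rfl⟩)
      · by_cases hiσ : i ∈ σ
        · exact Or.inr (Or.inl ⟨i, hiσ, rfl⟩)
        · simp only [hiσ, if_false, decide_eq_true_eq] at hi
          exact Or.inl (Or.inl ⟨i, hi, rfl⟩)
      · by_cases hiσ : i ∈ σ
        · exact Or.inr (Or.inr ⟨i, hiσ, rfl⟩)
        · simp only [hiσ, if_false, decide_eq_true_eq] at hi
          exact Or.inl (Or.inr ⟨i, hi, rfl⟩)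
    · rintro ((⟨i, hi, rfl⟩ | ⟨i, hi, rfl⟩) | (⟨i, hi, rfl⟩ | ⟨i, hi, rfl⟩))
      · refine Or.inl ⟨i, ?_, rfl⟩
        by_cases hiσ : i ∈ σ
        · simp [hiσ]
        · simp [hiσ, hi]
      · refine Or.inr ⟨i, ?_, rfl⟩
        by_cases hiσ : i ∈ σ
        · simp [hiσ]
        · simp [hiσ, hi]
      · exact Or.inl ⟨i, by simp [hi], rfl⟩
      · exact Or.inr ⟨i, by simp [hi], rfl⟩
  refine add_nonneg ?_ (Finset.sum_nonneg fun e he => hglued e fun h => ?_)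
  swap
  · rw [Finset.mem_compl, h] at he
    exact he (Finset.mem_insert_self _ _)
  -- the two rotation words equal the hair budget
  have hrot : ∀ e : Fin 3 → Fin 3, ((∀ i, e i = 1) ∨ (∀ i, e i = 2)) → ∀ (σ : Finset (Fin 3)) (u : Fin n),
      u ∈ (Finset.univ.filter fun i => (if i ∈ σ then (true, true) else (decide (e i = 1), decide (e i = 2))).1 = true).image p ∪
        (Finset.univ.filter fun i => (if i ∈ σ then (true, true) else (decide (e i = 1), decide (e i = 2))).2 = true).image p' ↔
      ∃ d, u = q d := by
    intro e he σ u
    simp only [Finset.mem_union, Finset.mem_image, Finset.mem_filter, Finset.mem_univ, true_and]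
    constructor
    · rintro (⟨i, -, rfl⟩ | ⟨i, -, rfl⟩)
      · exact ⟨i + 1, hp i⟩
      · exact ⟨i + 2, hp' i⟩
    · rintro ⟨d, rfl⟩
      rcases he with he | he
      · refine Or.inl ⟨d + 2, ?_, by rw [hp, (fin3_facts d).2.2.2.2.2.1]⟩
        by_cases h : d + 2 ∈ σ
        · simp [h]
        · simp [h, he]
      · refine Or.inr ⟨d + 1, ?_, by rw [hp', (fin3_facts d).2.2.2.2.1]⟩
        by_cases h : d + 1 ∈ σ
        · simp [h]
        · simp [h, he]
  rw [rotationWord_eq w A s p p' q c j hj hqA hq _ (hrot e₁ (Or.inl fun _ => rfl)),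
    rotationWord_eq w A s p p' q c j hj hqA hq _ (hrot e₂ (Or.inr fun _ => rfl))]
  -- the comonotone word with the rotation budget
  have hC0 : 0 ≤ ∏ i, (if (w s(s i, p i) : ℝ) * w s(s i, p' i) < 1 then
      ((if e₀ i = 1 then (w s(s i, p i) : ℝ) else 1 - w s(s i, p i)) *
        (if e₀ i = 2 then (w s(s i, p' i) : ℝ) else 1 - w s(s i, p' i))) / (1 - (w s(s i, p i) : ℝ) * w s(s i, p' i))
      else if e₀ i = 1 then 1 else 0) :=
    Finset.prod_nonneg fun i _ => extremeCoeff_nonneg _ _ (w _).2.1 (w _).2.2 (w _).2.1 (w _).2.2 (e₀ i)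
  have hC1 : 0 ≤ ∏ i, (if (w s(s i, p i) : ℝ) * w s(s i, p' i) < 1 then
      ((if e₁ i = 1 then (w s(s i, p i) : ℝ) else 1 - w s(s i, p i)) *
        (if e₁ i = 2 then (w s(s i, p' i) : ℝ) else 1 - w s(s i, p' i))) / (1 - (w s(s i, p i) : ℝ) * w s(s i, p' i))
      else if e₁ i = 1 then 1 else 0) :=
    Finset.prod_nonneg fun i _ => extremeCoeff_nonneg _ _ (w _).2.1 (w _).2.2 (w _).2.1 (w _).2.2 (e₁ i)
  have hC2 : 0 ≤ ∏ i, (if (w s(s i, p i) : ℝ) * w s(s i, p' i) < 1 then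
      ((if e₂ i = 1 then (w s(s i, p i) : ℝ) else 1 - w s(s i, p i)) *
        (if e₂ i = 2 then (w s(s i, p' i) : ℝ) else 1 - w s(s i, p' i))) / (1 - (w s(s i, p i) : ℝ) * w s(s i, p' i))
      else if e₂ i = 1 then 1 else 0) :=
    Finset.prod_nonneg fun i _ => extremeCoeff_nonneg _ _ (w _).2.1 (w _).2.2 (w _).2.1 (w _).2.2 (e₂ i)
  have hbud := triangle_extremeCoeff_budget (fun i => (w s(s i, p i) : ℝ)) (fun i => (w s(s i, p' i) : ℝ))
    (fun i => (w _).2.1) (fun i => (w _).2.2) (fun i => (w _).2.1) (fun i => (w _).2.2) e₀ e₁ e₂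
    (fun _ => rfl) (fun _ => rfl) (fun _ => rfl)
  beta_reduce at hbud
  have key := comonotone_word_budget_triangle w A s p p' q hp hp' c j hj hs hsA hqA hq hcA hcq hobs hdom _ _ hC0
    (add_nonneg hC1 hC2) hbud
  have hY : ∀ (σ : Finset (Fin 3)) (u : Fin n),
      u ∈ (Finset.univ.filter fun i => (if i ∈ σ then (true, true) else (decide (e₀ i = 1), decide (e₀ i = 2))).1 = true).image p ∪
        (Finset.univ.filter fun i => (if i ∈ σ then (true, true) else (decide (e₀ i = 1), decide (e₀ i = 2))).2 = true).image p' ↔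
      u ∈ σ.image p ∪ σ.image p' := by
    intro σ u
    simp only [he₀, Finset.mem_union, Finset.mem_image, Finset.mem_filter, Finset.mem_univ, true_and]
    constructor
    · rintro (⟨i, hi, rfl⟩ | ⟨i, hi, rfl⟩)
      · by_cases hiσ : i ∈ σ
        · exact Or.inl ⟨i, hiσ, rfl⟩
        · simp [hiσ] at hi
      · by_cases hiσ : i ∈ σ
        · exact Or.inr ⟨i, hiσ, rfl⟩
        · simp [hiσ] at hi
    · rintro (⟨i, hi, rfl⟩ | ⟨i, hi, rfl⟩)
      · exact Or.inl ⟨i, by simp [hi], rfl⟩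
      · exact Or.inr ⟨i, by simp [hi], rfl⟩
  have hYeq : ∀ σ : Finset (Fin 3),
      (Finset.univ.filter fun i => (if i ∈ σ then (true, true) else (decide (e₀ i = 1), decide (e₀ i = 2))).1 = true).image p ∪
        (Finset.univ.filter fun i => (if i ∈ σ then (true, true) else (decide (e₀ i = 1), decide (e₀ i = 2))).2 = true).image p' =
      σ.image p ∪ σ.image p' := fun σ => Finset.ext fun u => hY σ u
  simp only [hYeq]
  linarith [key]

end StarSet

end Summit.CriticalPhenomena.PercolationContinuityZ3.Theorems

end
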